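import HarnessLib.Audit.LibrarySuggestionsDenyListCorCM
import Summits.HodgeConjecture.HodgeConjecture.Theorems.F0D9opRoad2Body
import Summits.HodgeConjecture.HodgeConjecture.Theorems.F0P6aPointwiseFrobenius

-- `Lines/F0D9opRoad2Mod.lean` — ED. 6 «MOD INTERFACE» module of the sub-line `Cruxes/HLiu418/Lines/F0_D9opRoad2` (P6 LEAD F0P6-plan (g0),
-- ruling M-1, 2026-09-01).  SORRY-FREE, importable.  DOOR = P″ (pointwise): the parent `Lines/F0_D9opRoad2.lean` ED. 6 imports this module and
-- replaces `stub_MODv3 := modv3_of_modv2 stub_MOD …` by `stub_MODv3 := modv3_of_core_quot stub_PWcore stub_MODquot` over the TWO registered-to-be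
-- stubs `stub_PWcore : RecordModuliPointwiseCoreCofinal` (moduli core, XL) and `stub_MODquot : RecordTameLevelQuotientModel` (★-provable, M–L);
-- the print-shape door `stub_MOD` (correspondence level) leaves the cone.  No decl of the Body or of `F0_P6a_PointwiseFrobenius` is changed.

/-!
# `F0D9opRoad2Mod` — ★ RE-HOME (rung-0 re-homing task, books INVENTORY §8.4 M-3; LEAD F0P6-plan (g4) «M-72») of the crux workfile `Lines/F0D9opRoad2Mod.lean`

This `Theorems/` module is the TREE BYTES of `Summits/HodgeConjecture/HodgeConjecture/Cruxes/HLiu418/Lines/F0D9opRoad2Mod.lean` (edition of record,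
tree sha16 db46daf2ae2b2249, 234 l., code-`sorry`-free) with the NAMESPACE KEPT — `Summit.HodgeConjecture.HodgeConjecture.Cruxes.HLiu418.F0D9opRoad2` — so that every
fully-qualified name (`PointwiseFrobeniusDatumAt`, `for`, `RecordModuliPointwiseCoreCofinal`, `RecordTameLevelQuotientModel`, `pw_of_core_quot`, `modv3_of_core_quot`; 6 declarations) is UNCHANGED; only this module
docstring is re-headed and the `Lines` imports are switched to their ★ re-homed twins (`F0D9opRoad2Body` → `Theorems.F0D9opRoad2Body`, `F0_P6a_PointwiseFrobenius` → `Theorems.F0P6aPointwiseFrobenius`).  Why a re-home: a `Theorems/` file cannot import a `Lines/` workfile (F0P6-ref1 o-6), and closing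
stmt-HodgeConjecture-24832 `--as proved --by <Theorems decl>` at rung 0 needs the sorry-free Lines chain behind the gate (RE-HOME MAP v1.1, LA7-plan (g4),
2026-09-02; director g27 s1336 (R1)–(R3)).    Lines importers of the original: `F0_D9opRoad2`, `F0_P6a_ModuliDatum`, `F0_P6c_IsogenyDictionary`, `F0_P6q_TameLevelQuotient`.
After this file is ★ the Lines workfile is meant to become a one-import SHIM of it (a `Lines/` write, batched per cone on the LEAD's word), so no
environment ever holds two copies (NO-CROSS-IMPORT rule, «M-72» (3)).  It asserts nothing beyond what the workfile already proves.

## Original module docstring (verbatim)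
## ED. 6 «MOD INTERFACE» of the sub-line `Cruxes/HLiu418/Lines/F0-D9opRoad2` (crux item stmt-HodgeConjecture-24832) — door P″

RULING M-1 (P6 LEAD).  The road-neutral boundary of the parent line is MODv3 = `F0D9opRoad2.RecordCurveCongruenceOnPointsCofinal` (BODY
:604–:657); the sub-line `F0_P6a_PointwiseFrobenius` (F0P6a-plan) proves `DEG → PW → MODv3` with PW = `RecordCurvePointwiseFrobeniusDichotomyCofinal`
(the pointwise ordinary ∕ supersingular dichotomy at the `N w + 1` translates, [Liu2021] Prop. D.8 (1)–(3) + proof of Cor. D.9 read on `κ̄`-points,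
[Carayol1986Compositio] §10.3, [DiamondShurman2005] Thm. 8.7.2) and DEG ★-inhabited.  This module CUTS PW into the two statements a moduli road
produces, and proves the glue:

* `PointwiseFrobeniusDatumAt … w hw Kc 𝒮c h𝒮c` — PW՚s inner `∀ N′ rc₁ … x′, FrobeniusDichotomy …` block REIFIED as a predicate of the level `Kc`
  and the smooth proper model `𝒮c` (token-for-token `F0_P6a_PointwiseFrobenius` :128–:148);
* `RecordModuliPointwiseCoreCofinal` (stub `stub_PWcore`, XL — THE MODULI CORE): for every record datum and small level `K`, a finite `S₃(K)`
  such that at every split place `w ∉ S₃` with `J⋆_w ∈ GL₂(𝒪_w)` and `K` hyperspecial-factorisable at `w|F⁺` there are: a sublevel `Kc ≤ K`,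
  hyperspecial-factorisable and NORMALISED by `K`, the finite group `G = K⁄Kc` (a surjection `φ : K ↠ G`, `ker φ = Kc`) of order invertible in
  `𝒪_{F,(w)}`, a smooth proper model `𝒮c` of `M⋆_{Kc}` over `𝒪_{F,(w)}` with an action `ρ` of `G` over `Spec 𝒪_{F,(w)}` whose generic fibre is the
  record translate `k ↦ T_{k⁻¹}` (convention of ★ `RecordSystemGS.IsLevelQuotient`), every point in a `G`-stable affine open, AND the pointwise
  Frobenius datum at `(Kc, 𝒮c)`.  In print: `Kc` = the normal core in `K` of `K ∩ K(𝔫)` for an auxiliary level `𝔫` deep enough for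
  representability; `𝒮c = 𝓜_{Kc} ⊗ 𝒪_{F,(w)}`, the fine moduli scheme of the RSZ∕Kottwitz PEL problem for `n = 2` over a ring of `S`-integers, base
  changed ([RapoportSmithlingZhang2020] §4.1; [Kottwitz1992] §5), SMOOTH AND PROPER at every `w ∉ S₃(K)` by SPREADING OUT its smooth projective generic
  fibre `M⋆_{Kc}` (★ `Limits.LocApprox.exists_forall_smooth_isProper_flat_snd_of_isSmoothProjective`, EGA IV₃ 8.10.5 (xii) ∕ IV₄ 17.7.8 — no
  deformation theory and no Néron models on this road); `ρ` = `η ↦ η g` on level structures; the dichotomy = canonical subgroup ∕ supersingular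
  uniqueness on `κ̄(w)`-points of the universal abelian scheme.  Owner: sub-line F0-P6a (`F0_P6a_ModuliDatum`: REP, GEN, LEV, SPREAD ★, HEART).
* `RecordTameLevelQuotientModel` (stub `stub_MODquot`, M–L, every input ★ — THE TAME LEVEL-QUOTIENT PACKAGING): from the data of the core at
  `(K, w, Kc, G, φ, 𝒮c, ρ)`, the quotient `𝒮 := 𝒮c⁄G` is a smooth proper model of `M⋆_K` with `ū : 𝒮c ⟶ 𝒮` of generic fibre `u_{Kc→K}`
  (★ `Motives.IntegralModel.exists_quotient_of_isProper`, ★ `ActionOver.smoothOfRelativeDimension_one_and_isProper_gluedDesc_of_isUnit_card`,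
  ★ `RecordSystemGS.isLevelQuotient_holds`, ★ `Motives.isoFiniteQuotient_of_isSepQuotient`).  Hand M-Q.
* GLUE (kernel-checked, pure logic): `pw_of_core_quot : RecordModuliPointwiseCoreCofinal → RecordTameLevelQuotientModel → PW` and
  `modv3_of_core_quot : RecordModuliPointwiseCoreCofinal → RecordTameLevelQuotientModel → RecordCurveCongruenceOnPointsCofinal`
  (through `F0P6aPointwiseFrobenius.congruenceOnPointsCofinal_of_dichotomy deg_holds`).

WHY THIS CUT.  `S₃(K)` is free, so smoothness AND properness of the model come from the generic fibre by spreading out (price: representability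
over the GLOBAL base `𝒪_F[1⁄N]` + the generic-fibre comparison with the record, both needed anyway); the level quotient is the one piece provable
today from ★ organs, and TAMENESS (`#G ∈ 𝒪_{F,(w)}ˣ`, the primes dividing `[K:Kc]` go into `S₃(K)`) replaces freeness of the action (no Serre
rigidity needed: [KatzMazur1985] A7.1).  The correspondence-level door R (`RecordCurveCongruenceCorrespondenceCofinal`, `𝒯 = 𝓜_{Kc ∩ Γ₀(w)}`, finite
flat `π₁`, open `V`) stays typed in the Body and enterable through the parent՚s proved `modv3_of_modv2`, but is OFF the critical path: PW needs no
`𝒯`, no flatness, no open immersion.  HC_CM is proved only modulo the 2 remaining named inputs (hLiu418 24832, h413 24833) — behind them the booked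
printed statements + the MOD package — until rung 0 closes; this module changes no count. -/

namespace Summit.HodgeConjecture.HodgeConjecture.Cruxes.HLiu418.F0D9opRoad2

set_option linter.dupNamespace false  -- `Summit.HodgeConjecture.HodgeConjecture.…` BY DESIGN (D-0017), as in `Lines/d6_cm_curve.lean`

open CategoryTheory NumberField IsDedekindDomain MulAction
open scoped Matrix
open Literature.NumberTheory.GaloisRepresentations
open Literature.NumberTheory.Automorphic Literature.NumberTheory.Automorphic.UnitaryGroup
open Literature.AlgebraicGeometry.ShimuraVarieties.UnitaryCanonicalModel
open Literature.NumberTheory.Automorphic.Liu2021.AppendixC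
open Literature.AlgebraicGeometry.Motives (AlgPoints IntegralModel frobeniusOver SchemeOver)
open Literature.NumberTheory.DiophantineGeometry (geomResidueField)
open Literature.AlgebraicGeometry.RelativeSpec (ActionOver)
open Literature.NumberTheory.EllipticCurves (genericFibre)
open Summit.HodgeConjecture.HodgeConjecture.Cruxes.HLiu418.F0P6aPointwiseFrobenius
  (FrobeniusDichotomy RecordCurvePointwiseFrobeniusDichotomyCofinal congruenceOnPointsCofinal_of_dichotomy deg_holds)

section Edition6Mod

/-- **PW՚s inner block REIFIED — `PointwiseFrobeniusDatumAt … w hw Kc 𝒮c h𝒮c`**: at the small level `Kc` and the smooth proper model `𝒮c` of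
`M⋆_{Kc}` over `𝒪_{F,(w)}` (`w` split, `t₁ = heckeElementAt … 1`, `t₂ = heckeElementAt … 2`): for every deeper small level `N′ ≤ Kc`, coset
representatives `rc₁` of `Kc t₁ Kc ⁄ Kc` and `rc₂` of `Kc t₂ Kc ⁄ Kc` with `rcᵢ β ⁻¹ N′ rcᵢ β ⊆ Kc`, and every point `x′ ∈ M⋆_{N′}(Ω)`, the
pointwise Frobenius dichotomy `FrobeniusDichotomy F x̄ ȳ z̄` of the reductions (`F0_P6a_PointwiseFrobenius` §0–§1, token-for-token its :128–:148):
ORDINARY — one `β₀` with `ȳ_{β₀} = F x̄` and `F ȳ_β = z̄` for `β ≠ β₀`; SUPERSINGULAR — every `ȳ_β = F x̄` and `F (F x̄) = z̄`.  `Prop`-valued;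
nothing asserted.  (print: Liu2021, Prop. D.8 (1)–(3) p. 135 and proof of Cor. D.9 p. 139 L4–L31) (print: Carayol1986Compositio, §10.3, Prop. p. 211)
(print: DiamondShurman2005, §8.7 p. 353, Thm. 8.7.2 p. 358) -/
def PointwiseFrobeniusDatumAt (F : Type) [Field F] [NumberField F] [IsCMField F] (ι₁ : F →+* ℂ)
    (Jstar : Matrix (Fin 2) (Fin 2) F)
    (K₀ : C5.OpenCompactSubgroup ↥(finAdelic ↥(maximalRealSubfield F) F (IsCMField.complexConj F) 2 Jstar))
    (S : RecordSystemGS F Jstar ι₁ K₀) (hU7ₛ : S.HeckeTranslateDefinedOver)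
    (hJ : (Jstar.map (IsCMField.complexConj F))ᵀ = Jstar) (hJu : IsUnit Jstar)
    (w : HeightOneSpectrum (𝓞 F)) (hw : (IsCMField.complexConj F) • w ≠ w)
    (Kc : C5.SmallLevel K₀)
    (𝒮c : IntegralModel (HeightOneSpectrum.valuationSubringAtPrime F w) F (S.M.obj Kc)) (h𝒮c : 𝒮c.IsSmoothProper 1) : Prop :=
  haveI : AlgebraicGeometry.IsProper 𝒮c.total.hom := h𝒮c.2
  ∀ (N' : C5.SmallLevel K₀) (hN'Kc : N' ≤ Kc)
    (rc₁ : orbit (Kc.1.1 : Subgroup ↥(finAdelic ↥(maximalRealSubfield F) F (IsCMField.complexConj F) 2 Jstar))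
         ((UnitaryGroup.heckeElementAt ↥(maximalRealSubfield F) F (IsCMField.complexConj F) 2 Jstar
             (⟨w, rfl⟩ : UnitaryGroup.PlacesOver F (w.under (𝓞 ↥(maximalRealSubfield F))))
             (IsCMField.complexConj_ne_one F) hJ hw (UnitaryGroup.isUnit_placeForm Jstar hJu w) (HeckeCharacter.uniformizer F w) 1 :
           ↥(finAdelic ↥(maximalRealSubfield F) F (IsCMField.complexConj F) 2 Jstar)) :
           ↥(finAdelic ↥(maximalRealSubfield F) F (IsCMField.complexConj F) 2 Jstar) ⧸
             (Kc.1.1 : Subgroup ↥(finAdelic ↥(maximalRealSubfield F) F (IsCMField.complexConj F) 2 Jstar))) →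
       ↥(finAdelic ↥(maximalRealSubfield F) F (IsCMField.complexConj F) 2 Jstar)),
    (∀ β, ((rc₁ β : ↥(finAdelic ↥(maximalRealSubfield F) F (IsCMField.complexConj F) 2 Jstar)) :
        ↥(finAdelic ↥(maximalRealSubfield F) F (IsCMField.complexConj F) 2 Jstar) ⧸
          (Kc.1.1 : Subgroup ↥(finAdelic ↥(maximalRealSubfield F) F (IsCMField.complexConj F) 2 Jstar))) = β.1) →
    ∀ (hrcN₁ : ∀ β, C5.HeckeLE (rc₁ β) N' Kc)
      (rc₂ : orbit (Kc.1.1 : Subgroup ↥(finAdelic ↥(maximalRealSubfield F) F (IsCMField.complexConj F) 2 Jstar))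
         ((UnitaryGroup.heckeElementAt ↥(maximalRealSubfield F) F (IsCMField.complexConj F) 2 Jstar
             (⟨w, rfl⟩ : UnitaryGroup.PlacesOver F (w.under (𝓞 ↥(maximalRealSubfield F))))
             (IsCMField.complexConj_ne_one F) hJ hw (UnitaryGroup.isUnit_placeForm Jstar hJu w) (HeckeCharacter.uniformizer F w) 2 :
           ↥(finAdelic ↥(maximalRealSubfield F) F (IsCMField.complexConj F) 2 Jstar)) :
           ↥(finAdelic ↥(maximalRealSubfield F) F (IsCMField.complexConj F) 2 Jstar) ⧸
             (Kc.1.1 : Subgroup ↥(finAdelic ↥(maximalRealSubfield F) F (IsCMField.complexConj F) 2 Jstar))) →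
       ↥(finAdelic ↥(maximalRealSubfield F) F (IsCMField.complexConj F) 2 Jstar)),
    (∀ β, ((rc₂ β : ↥(finAdelic ↥(maximalRealSubfield F) F (IsCMField.complexConj F) 2 Jstar)) :
        ↥(finAdelic ↥(maximalRealSubfield F) F (IsCMField.complexConj F) 2 Jstar) ⧸
          (Kc.1.1 : Subgroup ↥(finAdelic ↥(maximalRealSubfield F) F (IsCMField.complexConj F) 2 Jstar))) = β.1) →
    ∀ (hrcN₂ : ∀ β, C5.HeckeLE (rc₂ β) N' Kc),
    ∀ x' : AlgPoints (S.M.obj N') (AlgebraicClosure (w.adicCompletion F)),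
      FrobeniusDichotomy (P := AlgPoints 𝒮c.reductionAt (geomResidueField w))
        (AlgPoints.map (frobeniusOver 𝒮c.reductionAt))
        (𝒮c.geomReductionMap (AlgPoints.map (S.M.map (homOfLE hN'Kc)) x'))
        (fun β => 𝒮c.geomReductionMap (AlgPoints.map (recordHeckeTranslateGS S hU7ₛ (rc₁ β) N' Kc (hrcN₁ β)) x'))
        (fun β => 𝒮c.geomReductionMap (AlgPoints.map (recordHeckeTranslateGS S hU7ₛ (rc₂ β) N' Kc (hrcN₂ β)) x'))

/-- **LETTER MOD-PWCORE — `RecordModuliPointwiseCoreCofinal`** (ED. 6, door P″; THE MODULI CORE).  For every record datum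
`(F, ι₁, J⋆, K₀, S, hU7ₛ, hJ, hJu)` and small level `K` there is a finite `S₃(K)` such that at every split place `w ∉ S₃` with
`J⋆_w ∈ GL₂(𝒪_w)` and `K` hyperspecial-factorisable at `w|F⁺` the moduli interpretation supplies: a sublevel `Kc ≤ K`, hyperspecial-factorisable
at `w|F⁺` and NORMALISED by `K` (`hn : ∀ k ∈ K, k⁻¹ Kc k ⊆ Kc`, the currency of ★ `levelQuotientUP_GS`; in print `Kc =` the normal core in `K` of
`K ∩ K(𝔫)`, `𝔫` an auxiliary level prime to `w`, chosen ONCE per `K`), the finite group `G = K⁄Kc` (a surjection `φ : K ↠ G` with `ker φ = Kc`) of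
order INVERTIBLE in `𝒪_{F,(w)}` (tameness; `[K : Kc]` depends on `K` only, so the primes dividing it go into `S₃(K)`), a smooth proper model `𝒮c`
of `M⋆_{Kc}` over `𝒪_{F,(w)}` (in print the fine moduli scheme `𝓜_{Kc}` of the RSZ∕Kottwitz PEL problem for `n = 2` over a ring of `S`-integers
`𝒪_F[1⁄N]`, base changed to `𝒪_{F,(w)}`; representable and quasi-projective [RapoportSmithlingZhang2020] §4.1 Thm. 4.1 (smooth, p. 17), [Kottwitz1992]
§5 pp. 389–391, [Lan2013] Thm. 1.4.1.11 ∕ Cor. 7.2.3.10; its generic fibre identified with `M⋆_{Kc}` by the complex uniformisation [Kottwitz1992] §8,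
[Deligne1971TravauxShimura] 4.11–4.13; SMOOTH AND PROPER at every `w ∉ S₃(K)` by SPREADING OUT the smooth projective generic fibre — ★
`Limits.LocApprox.exists_forall_smooth_isProper_flat_snd_of_isSmoothProjective`, EGA IV₃ 8.10.5 (xii), IV₄ 17.7.8 (ii) — so that NO properness
theorem for the moduli problem ([Kottwitz1992] §5 p. 392, [Lan2013] §5.3.3) and NO deformation-theoretic smoothness is consumed on this road),
an action `ρ` of `G` on `𝒮c` over `Spec 𝒪_{F,(w)}` (`η ↦ η g` on level structures) whose generic fibre through `𝒮c.genericIso'` is the record՚s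
translate `T_{k⁻¹}` for every `k ∈ K` (the convention of ★ `RecordSystemGS.IsLevelQuotient`: `act k = T_{k⁻¹}`), the hypothesis «every point
of `𝒮c` lies in a `G`-stable affine open» (projectivity over the local base, [MumfordAV1970] §7, SGA 1 V 1.8), and the POINTWISE FROBENIUS DATUM
`PointwiseFrobeniusDatumAt … w hw Kc 𝒮c` (the Eichler–Shimura picture on `κ̄(w)`-points of the universal abelian scheme: canonical subgroup at
ordinary points, uniqueness of the order-`N w` subgroup at supersingular points, `F² = ⟨ϖ⟩` there; [Liu2021] Prop. D.8 (1)–(3) + proof of Cor. D.9,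
[Carayol1986Compositio] §10.3, [DiamondShurman2005] Thm. 8.7.2, [Wedhorn2000CongruenceRelation]).  XL; the target of the sub-line F0-P6a
(`F0_P6a_ModuliDatum`: REP, GEN, LEV, SPREAD ★, DICT, HEART) with the finite-group-scheme organs of F0-P6b∕c∕d; split BY NAME over the moduli
datum at its ED. 2.  NOT asserted here.
(print: Liu2021, Prop. D.8 (1)–(3) p. 135 and proof of Cor. D.9 p. 139 L4–L31) (print: RapoportSmithlingZhang2020, §4.1 Thm. 4.1 p. 17, §2.3)
(print: Kottwitz1992, §5 pp. 389–392, §8) (print: Carayol1986Compositio, §10.3, Prop. p. 211) (print: DiamondShurman2005, §8.7 p. 353, Thm. 8.7.2 p. 358)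
(print: EGA4-3, 8.10.5 (xii)) (print: EGA4-4, 17.7.8 (ii)) -/
def RecordModuliPointwiseCoreCofinal : Prop :=
  ∀ (F : Type) [Field F] [NumberField F] [IsCMField F] [IsGalois ℚ F] (ι₁ : F →+* ℂ)
    (Jstar : Matrix (Fin 2) (Fin 2) F)
    (K₀ : C5.OpenCompactSubgroup ↥(finAdelic ↥(maximalRealSubfield F) F (IsCMField.complexConj F) 2 Jstar))
    (S : RecordSystemGS F Jstar ι₁ K₀) (hU7ₛ : S.HeckeTranslateDefinedOver)
    (hJ : (Jstar.map (IsCMField.complexConj F))ᵀ = Jstar) (hJu : IsUnit Jstar) (K : C5.SmallLevel K₀),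
    ∃ S₃ : Set (HeightOneSpectrum (𝓞 F)), S₃.Finite ∧
      ∀ w : HeightOneSpectrum (𝓞 F), w ∉ S₃ → ∀ hw : (IsCMField.complexConj F) • w ≠ w,
        (UnitaryGroup.isUnit_placeForm Jstar hJu w).unit ∈ glInt 2 (w.adicCompletion F) →
          UnitaryGroup.IsHyperspecialAt ↥(maximalRealSubfield F) F (IsCMField.complexConj F) 2 Jstar K.1.1
            (w.under (𝓞 ↥(maximalRealSubfield F))) →
          ∃ (Kc : C5.SmallLevel K₀) (_hKcK : Kc ≤ K)
            (_hKc : UnitaryGroup.IsHyperspecialAt ↥(maximalRealSubfield F) F (IsCMField.complexConj F) 2 Jstar Kc.1.1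
               (w.under (𝓞 ↥(maximalRealSubfield F))))
            (hn : ∀ k ∈ K.1.1, C5.HeckeLE k Kc Kc)
            (G : Type) (_ : Group G) (_ : Finite G) (φ : ↥K.1.1 →* G) (_hφ : Function.Surjective φ)
            (_hφker : φ.ker = (Kc.1.1 : Subgroup ↥(finAdelic ↥(maximalRealSubfield F) F (IsCMField.complexConj F) 2 Jstar)).subgroupOf K.1.1)
            (_hcard : IsUnit ((Nat.card G : ℕ) : HeightOneSpectrum.valuationSubringAtPrime F w))
            (𝒮c : IntegralModel (HeightOneSpectrum.valuationSubringAtPrime F w) F (S.M.obj Kc)) (h𝒮c : 𝒮c.IsSmoothProper 1)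
            (ρ : ActionOver 𝒮c.total.hom G)
            (_hcov : ∀ x : ↥𝒮c.total.left, ∃ O : ρ.StableAffineOpens, x ∈ O.1)
            (_hρ : ∀ k : ↥K.1.1,
               (genericFibre (HeightOneSpectrum.valuationSubringAtPrime F w) F).map (Over.isoMk (ρ.aut (φ k)) (ρ.aut_comp (φ k))).hom
                   ≫ 𝒮c.genericIso'.hom
                 = 𝒮c.genericIso'.hom ≫
                     recordHeckeTranslateGS S hU7ₛ
                       ((k : ↥(finAdelic ↥(maximalRealSubfield F) F (IsCMField.complexConj F) 2 Jstar))⁻¹) Kc Kc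
                       (hn _ (K.1.1.inv_mem k.2))),
            PointwiseFrobeniusDatumAt F ι₁ Jstar K₀ S hU7ₛ hJ hJu w hw Kc 𝒮c h𝒮c

/-- **LETTER MOD-QUOT — `RecordTameLevelQuotientModel`** (ED. 6; the TAME LEVEL-QUOTIENT PACKAGING, moduli-free, every input ★).  For a record
datum, small levels `Kc ≤ K` with `Kc` normalised by `K`, the finite group `G = K/Kc` (`φ : K ↠ G`, `ker φ = Kc`) of order invertible in
`𝒪_{F,(w)}`, a smooth proper model `𝒮c` of `M⋆_{Kc}` over `𝒪_{F,(w)}` with an action `ρ` of `G` over `Spec 𝒪_{F,(w)}` whose generic fibre is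
`k ↦ T_{k⁻¹}` and every point in a `G`-stable affine open: the quotient `𝒮 := 𝒮c/G` is a smooth proper model of `M⋆_K` (★
`ActionOver.smoothOfRelativeDimension_one_and_isProper_gluedDesc_of_isUnit_card`, [KatzMazur1985] A7.1 — TAME quotient of a smooth relative
curve; residue fields of `Spec 𝒪_{F,(w)}` perfect) with a model morphism `ū : 𝒮c ⟶ 𝒮` whose generic fibre, read through the two
`genericIso'`, is the transition `u_{Kc→K}` (★ `Motives.IntegralModel.exists_quotient_of_isProper` (iii), SGA 1 V Prop. 1.9 ∕ Cor. 1.5, applied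
to the generic quotient `u_{Kc→K} : M⋆_{Kc} → M⋆_K = M⋆_{Kc}/(K/Kc)`: ★ `RecordSystemGS.isLevelQuotient_holds hJ hJu` ∕ ★ `levelQuotientUP_GS`
(Deligne 2.7.1 (c), a quotient for separated test objects), ★ `Motives.isoFiniteQuotient_of_isSepQuotient` + ★
`ActionOver.isGeometricQuotient_gluedMk` (Mumford AV §7: it is a geometric quotient, `M⋆_{Kc}` being projective by the record՚s (F1))).
M–L; PROVABLE NOW; dealt as a hand at ED. 6 (lands `--supports stmt-HodgeConjecture-24832`, then `stub_MODquot := …_holds`).  NOT asserted here.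
(print: KatzMazur1985, A7.1) (print: SGA1, Exp. V Prop. 1.8, Prop. 1.9, Cor. 1.5) (print: MumfordAV1970, §7 Thm. p. 66)
(print: Deligne1979ShimuraVarieties, 2.7.1 (b)–(c)) -/
def RecordTameLevelQuotientModel : Prop :=
  ∀ (F : Type) [Field F] [NumberField F] [IsCMField F] [IsGalois ℚ F] (ι₁ : F →+* ℂ)
    (Jstar : Matrix (Fin 2) (Fin 2) F)
    (K₀ : C5.OpenCompactSubgroup ↥(finAdelic ↥(maximalRealSubfield F) F (IsCMField.complexConj F) 2 Jstar))
    (S : RecordSystemGS F Jstar ι₁ K₀) (hU7ₛ : S.HeckeTranslateDefinedOver)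
    (_hJ : (Jstar.map (IsCMField.complexConj F))ᵀ = Jstar) (_hJu : IsUnit Jstar) (K : C5.SmallLevel K₀)
    (w : HeightOneSpectrum (𝓞 F))
    (Kc : C5.SmallLevel K₀) (hKcK : Kc ≤ K) (hn : ∀ k ∈ K.1.1, C5.HeckeLE k Kc Kc)
    (G : Type) [Group G] [Finite G] (φ : ↥K.1.1 →* G) (_hφ : Function.Surjective φ)
    (_hφker : φ.ker = (Kc.1.1 : Subgroup ↥(finAdelic ↥(maximalRealSubfield F) F (IsCMField.complexConj F) 2 Jstar)).subgroupOf K.1.1)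
    (_hcard : IsUnit ((Nat.card G : ℕ) : HeightOneSpectrum.valuationSubringAtPrime F w))
    (𝒮c : IntegralModel (HeightOneSpectrum.valuationSubringAtPrime F w) F (S.M.obj Kc)) (_h𝒮c : 𝒮c.IsSmoothProper 1)
    (ρ : ActionOver 𝒮c.total.hom G)
    (_hcov : ∀ x : ↥𝒮c.total.left, ∃ O : ρ.StableAffineOpens, x ∈ O.1)
    (_hρ : ∀ k : ↥K.1.1,
       (genericFibre (HeightOneSpectrum.valuationSubringAtPrime F w) F).map (Over.isoMk (ρ.aut (φ k)) (ρ.aut_comp (φ k))).hom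
           ≫ 𝒮c.genericIso'.hom
         = 𝒮c.genericIso'.hom ≫
             recordHeckeTranslateGS S hU7ₛ
               ((k : ↥(finAdelic ↥(maximalRealSubfield F) F (IsCMField.complexConj F) 2 Jstar))⁻¹) Kc Kc
               (hn _ (K.1.1.inv_mem k.2))),
    ∃ (𝒮 : IntegralModel (HeightOneSpectrum.valuationSubringAtPrime F w) F (S.M.obj K)) (_h𝒮 : 𝒮.IsSmoothProper 1)
      (ū : 𝒮c.total ⟶ 𝒮.total),
      (genericFibre (HeightOneSpectrum.valuationSubringAtPrime F w) F).map ū ≫ 𝒮.genericIso'.hom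
        = 𝒮c.genericIso'.hom ≫ S.M.map (homOfLE hKcK)


set_option maxHeartbeats 400000 in
/-- **GLUE `pw_of_core_quot` — PW from PWCORE and QUOT** (ED. 6, pure logic): `S₃ :=` the core՚s; at a split place `w ∉ S₃` with
`J⋆_w ∈ GL₂(𝒪_w)` and `K` hyperspecial-factorisable, the core gives `(Kc, G, φ, 𝒮c, ρ)` and the pointwise Frobenius datum at `(Kc, 𝒮c)`, the
quotient letter gives `(𝒮, ū)` with the generic square; these are exactly the witnesses of `RecordCurvePointwiseFrobeniusDichotomyCofinal`. [folklore] -/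
theorem pw_of_core_quot :
    RecordModuliPointwiseCoreCofinal → RecordTameLevelQuotientModel → RecordCurvePointwiseFrobeniusDichotomyCofinal := by
  intro hcore hquot F _ _ _ _ ι₁ Jstar K₀ S hU7ₛ hJ hJu K
  obtain ⟨S₃, hS₃, hcof⟩ := hcore F ι₁ Jstar K₀ S hU7ₛ hJ hJu K
  refine ⟨S₃, hS₃, fun w hw₃ hw hunit hhyp => ?_⟩
  obtain ⟨Kc, hKcK, hKc, hn, G, _instG, _instF, φ, hφ, hφker, hcard, 𝒮c, h𝒮c, ρ, hcov, hρ, hγ⟩ :=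
    hcof w hw₃ hw hunit hhyp
  obtain ⟨𝒮, h𝒮, ū, hū⟩ :=
    hquot F ι₁ Jstar K₀ S hU7ₛ hJ hJu K w Kc hKcK hn G φ hφ hφker hcard 𝒮c h𝒮c ρ hcov hρ
  refine ⟨𝒮, h𝒮, Kc, hKcK, hKc, 𝒮c, h𝒮c, ū, hū, ?_⟩
  intro N' hN'Kc rc₁ hrc₁ hrcN₁ rc₂ hrc₂ hrcN₂ x'
  exact hγ N' hN'Kc rc₁ hrc₁ hrcN₁ rc₂ hrc₂ hrcN₂ x'

/-- **GLUE `modv3_of_core_quot` — the road-neutral boundary MODv3 from PWCORE and QUOT** (ED. 6): through the sub-line՚s kernel-checked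
`congruenceOnPointsCofinal_of_dichotomy` and its ★-inhabited `deg_holds` (`F0_P6a_PointwiseFrobenius` §2–§3).  The parent՚s ED. 6 body of
`stub_MODv3`. [folklore] -/
theorem modv3_of_core_quot :
    RecordModuliPointwiseCoreCofinal → RecordTameLevelQuotientModel → RecordCurveCongruenceOnPointsCofinal :=
  fun hcore hquot => congruenceOnPointsCofinal_of_dichotomy deg_holds (pw_of_core_quot hcore hquot)

end Edition6Mod

end Summit.HodgeConjecture.HodgeConjecture.Cruxes.HLiu418.F0D9opRoad2
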